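import Literature.Analysis.Potential.HarmonicMeasureProofs
import Literature.Analysis.Pluripotential.NonPluripolarMongeAmpereMass
import Literature.Analysis.Complex.HarmonicMaxPrincipleExceptional
import Mathlib.Analysis.Complex.Harmonic.MeanValue
import HarnessLib

/-!
# Harmonic measure is dominated by non-negative harmonic majorants (finitely many exceptional points)

Topic `Literature/Analysis/Potential`; a complement to `HarmonicMeasure.lean` /
`HarmonicMeasureProofs.lean` (Perron harmonic measure `ω_D(z, B)` of Ransford, Def. 4.1.1 /
Def. 4.3.1). Everything here is proved; no named facts.

* `isSubharmonicOn_coe_of_harmonicOnNhd`: a real harmonic function on an open set is subharmonic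
  there as an `[-∞, +∞)`-valued function (Hörmander's mean-value form, via the mean value property
  of harmonic functions, Mathlib's `HarmonicOnNhd.circleAverage_eq`).
* `harmonicMeasure_le_of_harmonicOnNhd` (**upper bound by a harmonic majorant**): let `D ⊆ ℂ` be
  open and bounded, `h ≥ 0` harmonic on `D`, `T` a finite set of points off `D`, and suppose that at
  every point `ζ ∈ B ∖ T` one has `liminf_{w → ζ, w ∈ D} h(w) ≥ 1`. Then `ω_D(z, B) ≤ h(z)` for
  `z ∈ D`. Proof (Ransford's Lemma 4.1.6 argument `perron_indicator_le_div` with Lindelöf's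
  logarithmic barriers): for `ε > 0` the function `u_ε = 1 - h + ε ∑_{p ∈ T} log(‖· - p‖/R₀)`
  (`R₀` larger than all the distances involved) is subharmonic on `D`, `≤ 1`, with boundary
  `limsup ≤ 0` at every point of `B` (at the points of `T` it tends to `-∞`), so every member `v` of
  the Perron family of `1_B` satisfies `v + u_ε ≤ 1`, i.e. `H_D 1_B (z) ≤ h(z) - ε ∑ log(…)`; let
  `ε → 0`. This is how lower bounds `ω_D(z, B) ≥ t` on harmonic measures of boundary arcs are
  converted into information on explicit harmonic functions (conformal invariants), e.g. in
  Chelkak–Smirnov's crossing theorem (`Literature.Probability.LatticeModels.FKIsingQuadrilateralCrossing`).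

## References
* [Ransford1995] T. Ransford, *Potential Theory in the Complex Plane* (1995), Def. 4.1.1,
  Lemma 4.1.6, Thm. 3.6.9 (extended maximum principle; here only finitely many exceptional points,
  handled by logarithmic barriers as in Conway, Ch. X §1).
* [Conway1978] J. B. Conway, *Functions of One Complex Variable* (1978), Ch. X §1.
-/

noncomputable section

open _root_.Filter _root_.Set _root_.Metric _root_.Bornology
open scoped _root_.Topology
open Literature.Analysis.Pluripotential
open InnerProductSpace (HarmonicOnNhd HarmonicAt)

namespace Literature.Analysis.Potential

variable {D : Set ℂ}

/-- **A real harmonic function on an open set is subharmonic** (as an `[-∞, +∞)`-valued function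
in the mean-value sense of `IsSubharmonicOn`): it is continuous and has the mean value property
over every closed disc in the set. [cite: HormanderSCV1973, Thm. 1.6.2; Ransford1995, Def. 2.2.1] -/
theorem isSubharmonicOn_coe_of_harmonicOnNhd {h : ℂ → ℝ} (hh : HarmonicOnNhd h D) :
    IsSubharmonicOn (fun z ↦ ((h z : ℝ) : EReal)) D := by
  have hcont : ContinuousOn h D := fun z hz ↦ (hh z hz).1.continuousAt.continuousWithinAt
  refine ⟨upperSemicontinuousOn_of_continuousOn (continuous_coe_real_ereal.comp_continuousOn hcont),
    fun z _ ↦ EReal.coe_lt_top _, fun c R hR hcl ↦ ?_⟩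
  have hS : sphere c |R| ⊆ D := by
    rw [abs_of_pos hR]; exact sphere_subset_closedBall.trans hcl
  have hcb : HarmonicOnNhd h (closedBall c |R|) := by
    rw [abs_of_pos hR]; exact fun z hz ↦ hh z (hcl hz)
  rw [circleMean_coe_eq_circleAverage h c R ((hcont.mono hS).circleIntegrable'),
    _root_.HarmonicOnNhd.circleAverage_eq hcb]

/-- In `[-∞, +∞]`, a quantity which is `≤ c` for every real `c > 0` is `≤ 0`. [folklore] -/
theorem ereal_le_zero_of_forall_pos_le {x : EReal} (h : ∀ c : ℝ, 0 < c → x ≤ (c : EReal)) : x ≤ 0 := by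
  refine le_of_forall_gt_imp_ge_of_dense fun c hc ↦ ?_
  induction c using EReal.rec with
  | bot => exact absurd hc (not_lt.2 bot_le)
  | top => exact le_top
  | coe c => exact h c (by exact_mod_cast hc)

/-- **Harmonic measure is dominated by non-negative harmonic majorants, finitely many boundary
points excepted.** Let `D` be open and bounded, `h ≥ 0` harmonic on `D`, `T` a finite set of points
off `D`; if `liminf_{w → ζ, w ∈ D} h(w) ≥ 1` at every `ζ ∈ B ∖ T` (in the form: for every `ε > 0`,
eventually `h ≥ 1 - ε`), then `ω_D(z, B) ≤ h(z)` for every `z ∈ D`.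
[cite: Ransford1995, Def. 4.1.1 and Lemma 4.1.6 (with Thm. 3.6.9 for the exceptional points)] -/
theorem harmonicMeasure_le_of_harmonicOnNhd {B : Set ℂ} (hD : IsOpen D) (hDb : IsBounded D)
    {h : ℂ → ℝ} (hh : HarmonicOnNhd h D) (h0 : ∀ z ∈ D, 0 ≤ h z) (T : Finset ℂ)
    (hT : ∀ p ∈ T, p ∉ D)
    (hB : ∀ ζ ∈ B, ζ ∉ T → ∀ ε : ℝ, 0 < ε → ∀ᶠ w in 𝓝[D] ζ, 1 - ε ≤ h w)
    {z : ℂ} (hz : z ∈ D) : harmonicMeasure D z B ≤ h z := by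
  classical
  -- a radius exceeding all the distances `‖w - p‖`, `w ∈ D`, `p ∈ T`
  obtain ⟨ρ, hρ⟩ := hDb.subset_ball 0
  set R₀ : ℝ := |ρ| + ∑ p ∈ T, ‖p‖ + 1 with hR₀
  have hR₀pos : 0 < R₀ := by positivity
  have hdist : ∀ w ∈ D, ∀ p ∈ T, ‖w - p‖ < R₀ := by
    intro w hw p hp
    have h1 : ‖w‖ < ρ := by simpa using hρ hw
    have h2 : ‖p‖ ≤ ∑ q ∈ T, ‖q‖ := Finset.single_le_sum (fun q _ ↦ norm_nonneg q) hp
    calc ‖w - p‖ ≤ ‖w‖ + ‖p‖ := norm_sub_le w p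
      _ < R₀ := by rw [hR₀]; linarith [le_abs_self ρ]
  have hpos : ∀ w ∈ D, ∀ p ∈ T, 0 < ‖w - p‖ := fun w hw p hp ↦
    norm_pos_iff.2 (sub_ne_zero.2 fun hwp ↦ hT p hp (hwp ▸ hw))
  -- the logarithmic barrier `L = ∑_{p ∈ T} (log ‖w - p‖ - log R₀) ≤ 0` on `D`
  set L : ℂ → ℝ := fun w ↦ (∑ p ∈ T, Real.log ‖w - p‖) - (T.card : ℝ) * Real.log R₀ with hL
  have hL_eq : ∀ w, L w = ∑ p ∈ T, (Real.log ‖w - p‖ - Real.log R₀) := fun w ↦ by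
    rw [hL, Finset.sum_sub_distrib, Finset.sum_const, nsmul_eq_mul]
  have hterm : ∀ w ∈ D, ∀ p ∈ T, Real.log ‖w - p‖ - Real.log R₀ ≤ 0 := fun w hw p hp ↦
    sub_nonpos.2 (Real.log_le_log (hpos w hw p hp) (hdist w hw p hp).le)
  have hL_nonpos : ∀ w ∈ D, L w ≤ 0 := fun w hw ↦ by
    rw [hL_eq]; exact Finset.sum_nonpos fun p hp ↦ hterm w hw p hp
  have hL_harm : HarmonicOnNhd L D := by
    have h1 := Literature.Analysis.Complex.harmonicOnNhd_sum_log_norm_sub T hT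
    have h2 : HarmonicOnNhd (fun _ : ℂ ↦ (T.card : ℝ) * Real.log R₀) D :=
      fun w _ ↦ InnerProductSpace.harmonicAt_const _
    exact h1.sub h2
  -- the bound for each `ε > 0`
  have key : ∀ ε : ℝ, 0 < ε → harmonicMeasure D z B ≤ h z - ε * L z := by
    intro ε hε
    set u : ℂ → EReal := fun w ↦ ((1 - h w + ε * L w : ℝ) : EReal) with hu
    have hu_harm : HarmonicOnNhd (fun w ↦ 1 - h w + ε * L w) D := by
      have hc : HarmonicOnNhd (fun _ : ℂ ↦ (1 : ℝ)) D := fun w _ ↦ InnerProductSpace.harmonicAt_const _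
      have := (hc.sub hh).add (hL_harm.const_smul (c := ε))
      simpa [Pi.add_def, Pi.sub_def, Pi.smul_def, smul_eq_mul] using this
    have hu_sh : IsSubharmonicOn u D := isSubharmonicOn_coe_of_harmonicOnNhd hu_harm
    have huM : ∀ w ∈ D, u w ≤ (1 : ℝ) := fun w hw ↦ by
      rw [hu]
      exact EReal.coe_le_coe_iff.2 (by nlinarith [h0 w hw, hL_nonpos w hw])
    have hum : ∀ ζ ∈ B, limsup u (𝓝[D] ζ) ≤ (0 : ℝ) := by
      intro ζ hζ
      by_cases hζT : ζ ∈ T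
      · -- at an exceptional point the barrier tends to `-∞`
        have hr : 0 < R₀ * Real.exp (-ε⁻¹) := mul_pos hR₀pos (Real.exp_pos _)
        have hev : ∀ᶠ w in 𝓝[D] ζ, w ∈ D ∧ dist w ζ < R₀ * Real.exp (-ε⁻¹) :=
          eventually_mem_nhdsWithin.and
            (mem_nhdsWithin_of_mem_nhds (Metric.ball_mem_nhds ζ hr))
        refine Filter.limsup_le_of_le (h := hev.mono fun w ⟨hw, hwζ⟩ ↦ ?_)
        rw [hu, EReal.coe_zero]
        refine EReal.coe_le_coe_iff.2 ?_
        have hlog : Real.log ‖w - ζ‖ - Real.log R₀ < -ε⁻¹ := by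
          rw [dist_eq_norm] at hwζ
          have := Real.log_lt_log (hpos w hw ζ hζT) hwζ
          rw [Real.log_mul hR₀pos.ne' (Real.exp_pos _).ne', Real.log_exp] at this
          linarith
        have hLw : L w ≤ Real.log ‖w - ζ‖ - Real.log R₀ := by
          rw [hL_eq, ← Finset.add_sum_erase T _ hζT]
          have : ∑ p ∈ T.erase ζ, (Real.log ‖w - p‖ - Real.log R₀) ≤ 0 :=
            Finset.sum_nonpos fun p hp ↦ hterm w hw p (Finset.mem_of_mem_erase hp)
          linarith
        have hεL : ε * L w ≤ ε * (Real.log ‖w - ζ‖ - Real.log R₀) :=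
          mul_le_mul_of_nonneg_left hLw hε.le
        have hεi : ε * (-ε⁻¹) = -1 := by field_simp
        nlinarith [h0 w hw, mul_lt_mul_of_pos_left hlog hε]
      · -- at the other points of `B`, `h ≥ 1 - ε'` eventually, so `u ≤ ε'` eventually
        refine ereal_le_zero_of_forall_pos_le fun c hc ↦ ?_
        have hev : ∀ᶠ w in 𝓝[D] ζ, w ∈ D ∧ 1 - c ≤ h w :=
          eventually_mem_nhdsWithin.and (hB ζ hζ hζT c hc)
        refine Filter.limsup_le_of_le (h := hev.mono fun w ⟨hw, hwc⟩ ↦ ?_)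
        rw [hu]
        refine EReal.coe_le_coe_iff.2 ?_
        nlinarith [hL_nonpos w hw, hε]
    have hr : u z = ((1 - h z + ε * L z : ℝ) : EReal) := rfl
    have hP := perron_indicator_le_div hD hDb hu_sh huM hum one_pos hz hr
    have hP' : perron D (B.indicator 1) 0 z ≤ ((h z - ε * L z : ℝ) : EReal) := by
      convert hP using 2
      ring
    rw [harmonicMeasure_def]
    have hmin : min (perron D (B.indicator 1) 0 z) 1 ≤ ((h z - ε * L z : ℝ) : EReal) :=
      (min_le_left _ _).trans hP'
    have hbot : min (perron D (B.indicator 1) 0 z) 1 ≠ ⊥ :=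
      ne_bot_of_le_ne_bot (by simp) (le_min (perron_indicator_nonneg D z B) zero_le_one)
    have := EReal.toReal_le_toReal hmin hbot (EReal.coe_ne_top _)
    rwa [EReal.toReal_coe] at this
  -- `ε → 0`
  refine le_of_forall_pos_lt_add fun δ hδ ↦ ?_
  have hLz := hL_nonpos z hz
  have hε : 0 < δ / (1 - L z) := div_pos hδ (by linarith)
  have h1 := key _ hε
  have h2 : -(δ / (1 - L z) * L z) < δ := by
    rw [← mul_neg, div_mul_eq_mul_div, div_lt_iff₀ (by linarith)]
    nlinarith
  linarith

/-- **Corollary: single boundary points carry no harmonic measure** (for bounded open `D` and a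
point `p ∉ D`): `ω_D(z, {p}) = 0`. [cite: Ransford1995, Thm. 3.6.9 and Def. 4.3.1 (polar sets
are negligible)] -/
theorem harmonicMeasure_singleton_eq_zero (hD : IsOpen D) (hDb : IsBounded D) {p : ℂ} (hp : p ∉ D)
    {z : ℂ} (hz : z ∈ D) : harmonicMeasure D z {p} = 0 := by
  refine le_antisymm ?_ (harmonicMeasure_nonneg D z {p})
  have h := harmonicMeasure_le_of_harmonicOnNhd (B := {p}) hD hDb
    (h := fun _ ↦ (0 : ℝ)) (fun w _ ↦ InnerProductSpace.harmonicAt_const _) (fun _ _ ↦ le_rfl) {p}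
    (by simpa using hp) (fun ζ hζ hζT ↦ absurd (by simpa using hζ) hζT) hz
  simpa using h

/-- **Corollary: a finite set of boundary points carries no harmonic measure**: `ω_D(z, T) = 0`
for finite `T` off the bounded open set `D`. [cite: Ransford1995, Thm. 3.6.9 and Def. 4.3.1] -/
theorem harmonicMeasure_finset_eq_zero (hD : IsOpen D) (hDb : IsBounded D) (T : Finset ℂ)
    (hT : ∀ p ∈ T, p ∉ D) {z : ℂ} (hz : z ∈ D) : harmonicMeasure D z (T : Set ℂ) = 0 := by
  refine le_antisymm ?_ (harmonicMeasure_nonneg D z _)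
  have h := harmonicMeasure_le_of_harmonicOnNhd (B := (T : Set ℂ)) hD hDb
    (h := fun _ ↦ (0 : ℝ)) (fun w _ ↦ InnerProductSpace.harmonicAt_const _) (fun _ _ ↦ le_rfl) T
    hT (fun ζ hζ hζT ↦ absurd (by simpa using hζ) hζT) hz
  simpa using h

end Literature.Analysis.Potential
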